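import Summits.ValiantsHypothesis.ValiantsHypothesis.Theorems.BarrierLeverPartitionMinorsGenericChowProduct

/-!
# Route BarrierLever — Chow witnesses for partition minors (items 20172 / 20195): ONE product of
# affine forms hits any FINITE FAMILY of hit layouts

Helper file (`--supports stmt-ValiantsHypothesis-20172`; cell valiant-natproofs, rung V4, 𝒟-side of
door (c); seat val-np-p4 gen 14).  Closes NO item; no definitions.  The binary and ternary cases are in
the tree (`exists_common_chow_witness₂`, p-PairSplit; `exists_common_chow_witness₃`,
`…ChowDoubleStepPrelims`); the `k`-fold steps (`…ChowMultiTensorStepDet`, `…ChowStarGadgetStepDet`)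
need a common witness for the reduced layout AND `k` base entries, i.e. for a family of `k + 1`
layouts.  Same polynomial method (`…GenericChowProduct`): the generic partition determinants are
nonzero polynomials in the form coefficients, so is their product over the family, and a point where
the product does not vanish is a common witness.

* `exists_common_chow_witness_family` — for a finite index type `ι`, sizes `r i` and layouts
  `(U i, W i)` each hit by some product of `h + h` affine forms, ONE product hits them all.

WHAT THIS IS NOT: bookkeeping; nothing on items 20195 / 20172 / 19717 themselves, on crux
stmt-ValiantsHypothesis-14610, or on `VP` versus `VNP`.
-/

set_option linter.dupNamespace false

namespace Summit.ValiantsHypothesis.ValiantsHypothesis.Theorems.BarrierLever.ChowFactor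

open Finset MvPolynomial

noncomputable section

variable {h : ℕ}

/-- **A finite family of hit layouts is hit by one product of `h + h` affine forms.** -/
theorem exists_common_chow_witness_family {ι : Type*} [Fintype ι] (r : ι → ℕ)
    (U W : (i : ι) → Fin (r i) → Finset (Fin h))
    (hhit : ∀ i, ∃ ℓ : Fin (h + h) → MvPolynomial (Fin (h + h)) ℂ, (∀ k, (ℓ k).totalDegree ≤ 1) ∧
      (Matrix.of fun p q : Fin (r i) => coeff
        (∑ b ∈ U i p, Finsupp.single (Fin.castAdd h b) 1 + ∑ d ∈ W i q, Finsupp.single (Fin.natAdd h d) 1)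
        (∏ k, ℓ k)).det ≠ 0) :
    ∃ ℓ : Fin (h + h) → MvPolynomial (Fin (h + h)) ℂ, (∀ k, (ℓ k).totalDegree ≤ 1) ∧
      ∀ i, (Matrix.of fun p q : Fin (r i) => coeff
        (∑ b ∈ U i p, Finsupp.single (Fin.castAdd h b) 1 + ∑ d ∈ W i q, Finsupp.single (Fin.natAdd h d) 1)
        (∏ k, ℓ k)).det ≠ 0 := by
  classical
  -- the product of the generic determinants is a nonzero polynomial
  have hP : ∀ i, (Matrix.of fun p q : Fin (r i) => coeff
      (∑ b ∈ U i p, Finsupp.single (Fin.castAdd h b) 1 + ∑ d ∈ W i q, Finsupp.single (Fin.natAdd h d) 1)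
      (∏ k : Fin (h + h), (C (X (k, none)) + ∑ v : Fin (h + h), C (X (k, some v)) * X v :
        MvPolynomial (Fin (h + h)) (MvPolynomial (Fin (h + h) × Option (Fin (h + h))) ℂ)))).det ≠ 0 :=
    fun i => genericChow_det_ne_zero_of_hit (U i) (W i) (hhit i)
  have hprod := Finset.prod_ne_zero_iff.mpr fun i (_ : i ∈ (Finset.univ : Finset ι)) => hP i
  obtain ⟨θ, hθ⟩ : ∃ θ : Fin (h + h) × Option (Fin (h + h)) → ℂ, eval θ (∏ i, (Matrix.of fun p q : Fin (r i) =>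
      coeff (∑ b ∈ U i p, Finsupp.single (Fin.castAdd h b) 1 + ∑ d ∈ W i q, Finsupp.single (Fin.natAdd h d) 1)
      (∏ k : Fin (h + h), (C (X (k, none)) + ∑ v : Fin (h + h), C (X (k, some v)) * X v :
        MvPolynomial (Fin (h + h)) (MvPolynomial (Fin (h + h) × Option (Fin (h + h))) ℂ)))).det) ≠ 0 := by
    by_contra hall
    push Not at hall
    exact hprod (MvPolynomial.funext fun θ => by rw [hall θ, map_zero])
  rw [map_prod] at hθ
  refine ⟨fun k => C (θ (k, none)) + ∑ v : Fin (h + h), C (θ (k, some v)) * X v,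
    fun k => totalDegree_affine_le _ _, fun i => ?_⟩
  have e := Finset.prod_ne_zero_iff.mp hθ i (Finset.mem_univ i)
  rw [eval_det_coeff_genericChow θ (U i) (W i)] at e
  exact e

end

end Summit.ValiantsHypothesis.ValiantsHypothesis.Theorems.BarrierLever.ChowFactor
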